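import Summits.ABC.IUTFork.Conditional.GenuineKWildClassDedekind
import Summits.ABC.IUTFork.Conditional.HexHullThresholdGenuine
import Summits.ABC.IUTFork.Conditional.AbcOfSGenuineMChosenDepthRad
import Summits.ABC.IUTFork.Cor312LicenceExactOrdersMRational
import Summits.ABC.IUTFork.Cor312GenuineMWildLowerBound
import Literature.IUT.LogVolume.GenuineTowerLocalTypeTate
import HarnessLib

/-!
# Branch C, M line / R-W «GENUINE-NEG» at the WILD poles `p ∈ {3, 5}`: the M-LINE TWIN of the `δ`-cell engine
# (`Conditional/FreyHullThresholdGenuineWild`) — cells fail at every member of the local-type class ⟹ S_H FAILS at the summand-route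
# M-level sharp setting of the datum's OWN read-off ideles

PROOF-ONLY file (D-0012: 0 definitions, 0 `Prop` facts, no instance) of the abc-iut cell (rung LADDER-ABC:A2.RESCUE.W, lane P−; seat
abc-iut-w4-d094 gen 8, row «W:FREY-PINNED-28», M twins — closing the R-W numerics lead's M-TWIN-GAP for the 28 K rows of
`Conditional/FreyHullThresholdGenuineWildRows`). TAKES NO SIDE on [IUTchIII] Cor. 3.12 (S. Mochizuki, *Inter-universal Teichmüller theory
III*, Cor. 3.12 p. 173–174, Step (xi-f) p. 184) or on any author: every statement is about OUR typed objects (abc-iut-c312's M-level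
`settingPrVolSharpM` at `tOfIdeleData T.D (ideleDataOf T.D T.isVolumeInputOf)`, typed (Ind1)(Ind2), `Thm311ToCor312.Licence`,
`Cor312Vol.PilotKummerCompatHull`); SHARP hull-level reading (stronger than print); typed ≠ proved; refuted-as-typed ≠ refuted-in-print;
nothing here asserts abc proved or refuted.

HOW (all BY NAME). The M-setting licence for the datum's own ideles at rational `j` is DECIDED EXACTLY by abc-iut-w5-d166's
`licence_settingPrVolSharpM_tOfIdeleData_iff_orders_of_j_mem_range` (`Cor312LicenceExactOrdersMRational`, p467xxx lineage): `Licence ⟺ ∀ u i,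
e_u·(((i+1)²m_q(u) − (i+1)D_u − (i+2)R_in(u))/e_u) + (i+2)R_out(u) ≤ m_q(u)` in the EXACT local data of the one member `x₀(u) ∈ V̲_u` over each
rational prime (here supplied by classical choice at every `u`: `fibre_nonempty`, `unifChoice`, abc-iut-rh-typ-4's `HexHullThreshold.exists_innerRadius`
/ `exists_outerRadius`, the value group `IsUniformizer.2`, `exists_int_norm_tqM_eq_zpow`, `differentOrd_rescaledCompletion`). At the pole `u`
(`p_u = p ∈ {3, 5}`) the exact data are SANDWICHED by the one-sided kernel inputs of the K engine: `e_u = A·l` with `A` in the class of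
`GenuineK.ramificationIdx_F_wild_class_ratPoint` (`GenuineM.absRamificationIdx_kOfM_eq_mul_prime_ratPoint`, abc-iut-W-num-6), `m_q(u) = A·t`
(`norm_tqM_eq_rpow_ord_rat`, rational `j`), `D_u ≤ e − 1 + [p ∣ A]·e` (DEDEKIND, `multiplicity_differentIdeal_int_le_dedekind`), `R_in(u) ≤ ⌊e/(p−1)⌋ + 1`
(`rpow_le_norm_of_innerRadius`), `R_out(u) ≥ p^{a₀} − a₀·e` (`norm_le_rpow_of_mem_logUnits_turning`); the exact cell is MONOTONE in these
(`Int.ediv_le_ediv`), so the `δ`-cell failing with the one-sided inputs contradicts the licence — hence `¬ PilotKummerCompatHull`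
(`licence_of_pilotKummerCompatHull`, pinned reading) for every choice of the free context binders and Kummer data.
* `GenuineM.not_pilotKummerCompatHull_ratPoint_of_wildCells` — pole form; * `GenuineM.not_pilotKummerCompatHull_triple_of_wildCells` — abc-triple form.
HONEST SCOPE: SHARP reading; nothing about the printed GLOBAL inequality, the number-level `Cor22.Cor312AtDatum`, or any author's intended hull;
admissibility / Szpiro-badness / (P6) of `(ratPoint q₀, l)` and NON-EMPTINESS of the datum type are NOT claimed; refuted-as-typed ≠
refuted-in-print; no abc claim. [cite: Mochizuki2012, IUTchIII Cor. 3.12 Step (xi-f) p. 184; IUTchI Def. 3.1 (b)(e) p. 61–62; IUTchIV Prop. 1.1 p. 9,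
Prop. 1.2 (i)(ii) p. 10, Cor. 2.2 (ii) proof p. 44–46] [cite: DupuyHilado2025, §3.4, §4.9, §4.12] [cite: NeukirchANT1999, Ch. II (5.5), Ch. III (2.6)]
[cite: Serre1972, §1.11–§1.12] [claim: Mochizuki2012, status: disputed] for every IUT quotation.
-/

noncomputable section

open Set Function NumberField IsDedekindDomain

namespace Summit.ABC.IUTFork.Conditional

open Thm311 Thm311.Real Cor312 Cor312Vol Cor312Prov Literature.IUT.LogThetaLattice Literature.IUT.LogVolume
  Literature.IUT.HodgeTheaters Literature.IUT.LogVolume.ThetaData Literature.IUT.LogVolume.Cor22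
  Literature.IUT.LogVolume.LogEnvelope Literature.NumberTheory.NumberFields
open Literature.NumberTheory.GaloisRepresentations.Ultrametric
open Literature.NumberTheory.DiophantineGeometry Literature.NumberTheory.DiophantineGeometry.GenEll Summit.ABC.ABC.Theorems

/-- `p^{−X/e} ≤ p^{−Y/e} ⟹ Y ≤ X` for `p > 1`, `e > 0` (real exponents over an integer pair). [folklore] -/
private theorem le_of_rpow_neg_div_le {p : ℕ} (hp : 1 < p) {e : ℝ} (he : 0 < e) {X Y : ℤ}
    (h : (p : ℝ) ^ (-((X : ℝ) / e)) ≤ (p : ℝ) ^ (-((Y : ℝ) / e))) : Y ≤ X := by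
  have hp1 : (1 : ℝ) < p := by exact_mod_cast hp
  have h1 := (Real.rpow_le_rpow_left_iff hp1).mp h
  rw [neg_le_neg_iff, div_le_div_iff_of_pos_right he] at h1
  exact_mod_cast h1

/-- **The sandwich**: an EXACT cell holding with data `(D, R_in, R_out)` and the `δ`-cell FAILING with one-sided bounds `D ≤ δ`,
`R_in ≤ r_in`, `r_out ≤ R_out` (same `e > 0`, `P`, label `j = i + 1 ≥ 0`) is contradictory — the cell is antitone in `D`, `R_in` and monotone in
`R_out` (`Int.ediv_le_ediv`). [folklore] -/
private theorem sandwich_false {e P Dx δ Rin rin Rout rout i : ℤ} (he : 0 < e) (hi : 0 ≤ i + 1)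
    (hD : Dx ≤ δ) (hRin : Rin ≤ rin) (hRout : rout ≤ Rout)
    (hex : e * ((P * (i + 1) ^ 2 - (i + 1) * Dx - (i + 2) * Rin) / e) + (i + 2) * Rout ≤ P)
    (hneg : P - (i + 1 + 1) * rout < e * (((i + 1) ^ 2 * P - (i + 1) * δ - (i + 1 + 1) * rin) / e)) : False := by
  have hnum : (i + 1) ^ 2 * P - (i + 1) * δ - (i + 1 + 1) * rin ≤ P * (i + 1) ^ 2 - (i + 1) * Dx - (i + 2) * Rin := by
    nlinarith [mul_nonneg hi (sub_nonneg.2 hD), mul_nonneg (show (0:ℤ) ≤ i + 1 + 1 by linarith) (sub_nonneg.2 hRin)]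
  have hdiv := Int.mul_le_mul_of_nonneg_left (Int.ediv_le_ediv he hnum) he.le
  have hro : (i + 1 + 1) * rout ≤ (i + 2) * Rout := by
    nlinarith [mul_nonneg (show (0:ℤ) ≤ i + 1 + 1 by linarith) (sub_nonneg.2 hRout)]
  linarith

/-- **M-LINE ENGINE — GENUINE-NEG THROUGH THE `δ`-CELL AT A WILD POLE.** `q₀ ∈ ℚ`, a genuine Θ-volume datum `T` over `(ratPoint q₀, l)`, a finite
place `u` of `ℚ` with `p_u = p ∈ {3, 5}` (`p′ = 15/p`), `p ≠ l`, a pole of `j(q₀)` at `p` of order `2t` (NO hypothesis on `p ∣ t`), a label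
`i + 1 ≤ l⋆`. IF for EVERY `A` in the local-type class (`(p−1) ∣ A`, `15 ∣ A·t`, `A ∣ p(p−1)p′`, `p′ ∣ t ⇒ A ∣ p(p−1)`) the `δ`-cell FAILS at
`e = A·l`, `P_q = A·t`, `r_in = ⌊e/(p−1)⌋ + 1`, `r_out = p^{a₀} − a₀·e`, `δ = e − 1 + [p ∣ A]·e`, THEN at the summand-route M-level sharp setting of
`T`'s OWN read-off ideles (pinned reading) `Cor312Vol.PilotKummerCompatHull` FAILS for every choice of the free context binders and Kummer data.
M twin of `GenuineK.not_pilotKummerCompatHull_chosen_ratPoint_of_wildCells` (same cell hypothesis, verbatim), through abc-iut-w5-d166's exact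
decider `licence_settingPrVolSharpM_tOfIdeleData_iff_orders_of_j_mem_range` and the one-sided sandwich described in the module docstring.
[cite: Mochizuki2012, IUTchIII Cor. 3.12 Step (xi-f) p. 184; IUTchIV Prop. 1.2 (i)(ii) p. 10] [cite: NeukirchANT1999, Ch. II (5.5), Ch. III (2.6)]
[claim: Mochizuki2012, status: disputed] -/
theorem GenuineM.not_pilotKummerCompatHull_ratPoint_of_wildCells {q₀ : ℚ} {l : ℕ}
    (T : Cor22.ThetaVolumeDatumAt (ratPoint q₀) l) (u : FinitePlace ℚ) (p : ℕ) (hu : ratChar u = p) {p' : ℕ}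
    (hpq : (p = 3 ∧ p' = 5) ∨ (p = 5 ∧ p' = 3)) (hpl : p ≠ l) {t : ℕ} (ht : 0 < t)
    (hpole : ∀ v : HeightOneSpectrum (𝓞 ℚ), Rat.HeightOneSpectrum.natGenerator v = p →
      Literature.IUT.LogVolume.ord ℚ v (Cor22.jInv q₀) = -(2 * (t : ℤ)))
    {i : ℕ} (hi : i + 1 ≤ (l - 1) / 2)
    (hcell : ∀ A : ℕ, (p - 1) ∣ A → 15 ∣ A * t → A ∣ p * (p - 1) * p' →
      (p' ∣ t → A ∣ p * (p - 1)) →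
      ∃ a₀ : ℕ, (∀ a, a < a₀ → (1 : ℤ) * ((p : ℕ) : ℤ) ^ a * (((p : ℕ) : ℤ) - 1) < ((A * l : ℕ) : ℤ)) ∧
        ((A * l : ℕ) : ℤ) ≤ 1 * ((p : ℕ) : ℤ) ^ a₀ * (((p : ℕ) : ℤ) - 1) ∧
        ((A * t : ℕ) : ℤ) - (((i : ℕ) : ℤ) + 1 + 1) * (((p : ℕ) : ℤ) ^ a₀ - (a₀ : ℤ) * ((A * l : ℕ) : ℤ)) <
          ((A * l : ℕ) : ℤ) * (((((i : ℕ) : ℤ) + 1) ^ 2 * ((A * t : ℕ) : ℤ)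
            - (((i : ℕ) : ℤ) + 1) * (((A * l - 1 + (if p ∣ A then A * l else 0) : ℕ) : ℤ))
            - (((i : ℕ) : ℤ) + 1 + 1) * (((A * l) / (p - 1) + 1 : ℕ) : ℤ)) / ((A * l : ℕ) : ℤ))) :
    letI := T.instFieldF; letI := T.instNumberFieldF; letI := T.instAlgebraF; letI := T.instFieldK
    letI := T.instNumberFieldK; letI := T.instAlgebraK; letI := T.instFieldFbar; letI := T.instAlgebraFbar
    letI := T.instAlgebraKFbar; letI := T.instIsElliptic
    ∀ (M : Type) [Field M] [NumberField M]
      (archPk : ∀ (j : (thetaIndexOfInitial T.D).Label) (vQ : (thetaIndexOfInitial T.D).VQ),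
        Set ((logShellsOfInitialDH T.D (analyticLogvVal T.K)).Packet j vQ))
      (archSub : ∀ (j : (thetaIndexOfInitial T.D).Label) (v : (thetaIndexOfInitial T.D).V),
        Set ((logShellsOfInitialDH T.D (analyticLogvVal T.K)).Packet j ((thetaIndexOfInitial T.D).over v)))
      (Ψ : ℤ → ∀ v : (thetaIndexOfInitial T.D).V, v ∈ (thetaIndexOfInitial T.D).Vbad →
        Set ((logShellsOfInitialDH T.D (analyticLogvVal T.K)).StarPacket v))
      (act : ℤ → ∀ v : (thetaIndexOfInitial T.D).V, v ∈ (thetaIndexOfInitial T.D).Vbad →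
        (logShellsOfInitialDH T.D (analyticLogvVal T.K)).StarPacket v →
          Module.End ℚ ((logShellsOfInitialDH T.D (analyticLogvVal T.K)).StarPacket v))
      (Mmod : ℤ → ∀ j : (thetaIndexOfInitial T.D).LabelStar, Set ((logShellsOfInitialDH T.D (analyticLogvVal T.K)).GlobalPacket j.1))
      (region : ℤ → ∀ j : (thetaIndexOfInitial T.D).LabelStar, FinDivisor M → ∀ vQ : (thetaIndexOfInitial T.D).VQ,
        Set ((logShellsOfInitialDH T.D (analyticLogvVal T.K)).Packet j.1 vQ))
      (frobAdm : ℤ → ℤ → ∀ (j : (thetaIndexOfInitial T.D).Label) (vQ : (thetaIndexOfInitial T.D).VQ),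
        Set ((logShellsOfInitialDH T.D (analyticLogvVal T.K)).Packet j vQ) → Prop)
      (frobLogvol : ℤ → ℤ → ∀ (j : (thetaIndexOfInitial T.D).Label) (vQ : (thetaIndexOfInitial T.D).VQ),
        Set ((logShellsOfInitialDH T.D (analyticLogvVal T.K)).Packet j vQ) → ℝ)
      (frobΨ : ℤ → ℤ → ∀ v : (thetaIndexOfInitial T.D).V, v ∈ (thetaIndexOfInitial T.D).Vbad →
        Set ((logShellsOfInitialDH T.D (analyticLogvVal T.K)).StarPacket v))
      (frobMmod : ℤ → ℤ → ∀ j : (thetaIndexOfInitial T.D).LabelStar, Set ((logShellsOfInitialDH T.D (analyticLogvVal T.K)).GlobalPacket j.1))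
      (unitImage : ℤ → ℤ → ℕ → ∀ (j : (thetaIndexOfInitial T.D).Label) (vQ : (thetaIndexOfInitial T.D).VQ),
        Set ((logShellsOfInitialDH T.D (analyticLogvVal T.K)).Packet j vQ))
      (ballImage : ℤ → ℤ → ∀ (j : (thetaIndexOfInitial T.D).Label) (vQ : (thetaIndexOfInitial T.D).VQ),
        Set ((logShellsOfInitialDH T.D (analyticLogvVal T.K)).Packet j vQ))
      (thetaDiv : ℤ → ℤ → LgpDivisor M (thetaIndexOfInitial T.D).lstar)
      (n : ℤ) {HT : Type} {LogLink : HT → HT → Type} {IsFull : ∀ {s t : HT}, LogLink s t → Prop}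
      (lat : LGPGaussianLogThetaLattice LogLink IsFull)
      {Frd : Type} {IsoF : Frd → Frd → Type} {Ob : Frd → Type} {realify : Frd → Frd} {Strip : Type}
      {IsoS : Strip → Strip → Type} {Mv : ∀ v : (thetaIndexOfInitial T.D).V, v ∈ (thetaIndexOfInitial T.D).Vbad → Type}
      [∀ v h, Monoid (Mv v h)]
      (sig : GlobalLGPFrobenioidSignature (thetaIndexOfInitial T.D).lstar (thetaIndexOfInitial T.D).V
        (· ∈ (thetaIndexOfInitial T.D).Vbad) Frd IsoF Ob realify Strip IsoS Mv)
      (split : SplittingMonoids Mv) {ObΔ : Type} {N : ∀ v : (thetaIndexOfInitial T.D).V, v ∈ (thetaIndexOfInitial T.D).Vbad → Type}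
      [∀ v h, Monoid (N v h)] (qData : QPilotData ObΔ N)
      (qK : ∀ v : (thetaIndexOfInitial T.D).V, v ∈ (thetaIndexOfInitial T.D).Vbad →
        Set ((logShellsOfInitialDH T.D (analyticLogvVal T.K)).StarPacket v)),
      ¬ Cor312Vol.PilotKummerCompatHull
        (LatticeSituation.ofShells (logShellsOfInitialDH T.D (analyticLogvVal T.K)) M archPk archSub
          (summandPiecesPrM T.D (logvAnalyticVal_analyticLogvVal (K := T.K))).Adm (summandPiecesPrM T.D (logvAnalyticVal_analyticLogvVal (K := T.K))).logvol Ψ act Mmod region frobAdm frobLogvol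
          frobΨ frobMmod unitImage ballImage thetaDiv)
        (settingPrVolSharpM T.D (logvAnalyticVal_analyticLogvVal (K := T.K)) (tOfIdeleData T.D (ideleDataOf T.D T.isVolumeInputOf))
          (fun u x => tqM T.D (ratChar u) u (natCast_ratChar_mem u) (ideleDataOf T.D T.isVolumeInputOf) x) M archPk archSub Ψ act Mmod region n lat sig split qData
          (fun u x => tqM_ne_zero T.D (ratChar u) u (natCast_ratChar_mem u) (ideleDataOf T.D T.isVolumeInputOf) x)
          (GenuineM.finite_ratPlaces_under_S T.D).toFinset
          (fun u x hu => norm_tqM_eq_one_of_not_mem T.D (ratChar u) u (natCast_ratChar_mem u) (ideleDataOf T.D T.isVolumeInputOf) x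
            fun hx => hu ((Set.Finite.mem_toFinset _).mpr ⟨x, hx⟩)))
        (fun _ => Cor312.Setting.qRegion
          (settingPrVolSharpM T.D (logvAnalyticVal_analyticLogvVal (K := T.K)) (tOfIdeleData T.D (ideleDataOf T.D T.isVolumeInputOf))
          (fun u x => tqM T.D (ratChar u) u (natCast_ratChar_mem u) (ideleDataOf T.D T.isVolumeInputOf) x) M archPk archSub Ψ act Mmod region n lat sig split qData
          (fun u x => tqM_ne_zero T.D (ratChar u) u (natCast_ratChar_mem u) (ideleDataOf T.D T.isVolumeInputOf) x)
          (GenuineM.finite_ratPlaces_under_S T.D).toFinset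
          (fun u x hu => norm_tqM_eq_one_of_not_mem T.D (ratChar u) u (natCast_ratChar_mem u) (ideleDataOf T.D T.isVolumeInputOf) x
            fun hx => hu ((Set.Finite.mem_toFinset _).mpr ⟨x, hx⟩)))) qK := by
  classical
  letI := T.instFieldF; letI := T.instNumberFieldF; letI := T.instAlgebraF; letI := T.instFieldK
  letI := T.instNumberFieldK; letI := T.instAlgebraK; letI := T.instFieldFbar; letI := T.instAlgebraFbar
  letI := T.instAlgebraKFbar; letI := T.instIsElliptic
  subst hu
  haveI hpfact : Fact (ratChar u).Prime := inferInstance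
  intro M _ _ archPk archSub Ψ act Mmod region frobAdm frobLogvol frobΨ frobMmod unitImage ballImage thetaDiv n HT LogLink IsFull lat
    Frd IsoF Ob realify Strip IsoS Mv _ sig split ObΔ N' _ qData qK hSH
  have hp : (ratChar u).Prime := hpfact.out
  have hp2 : ratChar u ≠ 2 := by rcases hpq with ⟨h, -⟩ | ⟨h, -⟩ <;> omega
  have hl : l.Prime := T.D.l_prime
  have hpR : (1 : ℝ) < ((ratChar u : ℕ) : ℝ) := by exact_mod_cast hp.one_lt
  have hl0r : (0 : ℝ) < l := by exact_mod_cast hl.pos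
  have ht0z : (0 : ℤ) < t := by exact_mod_cast ht
  have hL := licence_of_pilotKummerCompatHull (hq := fun _ _ => rfl) (hc := hSH)
  set r := ideleDataOf T.D T.isVolumeInputOf with hrdef
  have hpole' : ∀ v : HeightOneSpectrum (𝓞 ℚ), Rat.HeightOneSpectrum.natGenerator v = ratChar u →
      Literature.IUT.LogVolume.ord ℚ v (Cor22.jInv q₀) < 0 := fun v hv => by rw [hpole v hv]; linarith
  have hjF : T.E.j = ((Cor22.jInv q₀ : ℚ) : T.F) := by rw [T.j_eq]; exact eq_ratCast _ _
  have hj : T.E.j ∈ Set.range (algebraMap ℚ T.F) := ⟨Cor22.jInv q₀, (eq_ratCast _ _).trans hjF.symm⟩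
  have hlstar : (thetaIndexOfInitial T.D).lstar = (l - 1) / 2 := rfl
  have hil : i < (thetaIndexOfInitial T.D).lstar := by rw [hlstar]; omega
  -- the exact decider's data at EVERY rational prime, by classical choice (all opaque local constants)
  have hfib : ∀ u' : FinitePlace ℚ, Nonempty ((thetaIndexOfInitial T.D).Fibre (Val.non u')) := fun u' => by
    obtain ⟨x, hx⟩ := (thetaIndexOfInitial T.D).fibre_nonempty (Val.non u'); exact ⟨⟨x, hx⟩⟩
  obtain ⟨x₀, -⟩ : ∃ x₀ : ∀ u' : FinitePlace ℚ, (thetaIndexOfInitial T.D).Fibre (Val.non u'), True :=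
    ⟨fun u' => Classical.choice (hfib u'), trivial⟩
  obtain ⟨ϖ, hϖ⟩ : ∃ ϖ : ∀ u' : FinitePlace ℚ, (kOfM T.D (ratChar u') u' (natCast_ratChar_mem u') (x₀ u'))ˣ,
      ∀ u', IsUniformizer (ϖ u') := ⟨fun u' => unifChoice _, fun u' => isUniformizer_unifChoice _⟩
  have hIn : ∀ u' : FinitePlace ℚ,
      ∃ (c : kOfM T.D (ratChar u') u' (natCast_ratChar_mem u') (x₀ u'))
        (ϖ' : (kOfM T.D (ratChar u') u' (natCast_ratChar_mem u') (x₀ u'))ˣ) (w : kOfM T.D (ratChar u') u' (natCast_ratChar_mem u') (x₀ u')),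
        c ≠ 0 ∧ (∀ o : kOfM T.D (ratChar u') u' (natCast_ratChar_mem u') (x₀ u'), ‖o‖ ≤ 1 →
          c * o ∈ logUnits (kOfM T.D (ratChar u') u' (natCast_ratChar_mem u') (x₀ u'))) ∧
        IsUniformizer ϖ' ∧ w ∉ logUnits (kOfM T.D (ratChar u') u' (natCast_ratChar_mem u') (x₀ u')) ∧
        ‖w‖ * ‖(ϖ' : kOfM T.D (ratChar u') u' (natCast_ratChar_mem u') (x₀ u'))‖ ≤ ‖c‖ := fun u' =>
    HexHullThreshold.exists_innerRadius (ratChar u') _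
  choose cin ϖ' wv hin0 hin hunif hwv hwle using hIn
  have hOut : ∀ u' : FinitePlace ℚ, ∃ c : kOfM T.D (ratChar u') u' (natCast_ratChar_mem u') (x₀ u'),
      c ∈ logUnits (kOfM T.D (ratChar u') u' (natCast_ratChar_mem u') (x₀ u')) ∧ c ≠ 0 ∧
        ∀ z ∈ logUnits (kOfM T.D (ratChar u') u' (natCast_ratChar_mem u') (x₀ u')), ‖z‖ ≤ ‖c‖ := fun u' =>
    HexHullThreshold.exists_outerRadius (ratChar u') _
  choose cout houtΛ hout0 hdom using hOut
  have hRinE : ∀ u', ∃ m : ℤ, ‖cin u'‖ = ‖(ϖ u' : kOfM T.D (ratChar u') u' (natCast_ratChar_mem u') (x₀ u'))‖ ^ m := fun u' => by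
    obtain ⟨m, hm⟩ := (hϖ u').2 (Units.mk0 (cin u') (hin0 u')); exact ⟨m, by rwa [Units.val_mk0] at hm⟩
  choose Rin hRin using hRinE
  have hRoutE : ∀ u', ∃ m : ℤ, ‖cout u'‖ = ‖(ϖ u' : kOfM T.D (ratChar u') u' (natCast_ratChar_mem u') (x₀ u'))‖ ^ m := fun u' => by
    obtain ⟨m, hm⟩ := (hϖ u').2 (Units.mk0 (cout u') (hout0 u')); exact ⟨m, by rwa [Units.val_mk0] at hm⟩
  choose Rout hRout using hRoutE
  have hmqE : ∀ u', ∃ m : ℤ, ‖tqM T.D (ratChar u') u' (natCast_ratChar_mem u') r (x₀ u')‖ =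
      ‖(ϖ u' : kOfM T.D (ratChar u') u' (natCast_ratChar_mem u') (x₀ u'))‖ ^ m := fun u' =>
    exists_int_norm_tqM_eq_zpow T.D (ratChar u') u' (natCast_ratChar_mem u') r (x₀ u') (hϖ u')
  choose mq hmq using hmqE
  obtain ⟨Dx, hDx⟩ : ∃ Dx : FinitePlace ℚ → ℕ, ∀ u',
      Dx u' = multiplicity (placeOfM T.D u' (x₀ u')).asIdeal (differentIdeal ℤ (𝓞 T.K)) := ⟨_, fun _ => rfl⟩
  have hD : ∀ u', differentOrd (ratChar u') (kOfM T.D (ratChar u') u' (natCast_ratChar_mem u') (x₀ u')) =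
      (Dx u' : ℝ) / absRamificationIdx (ratChar u') (kOfM T.D (ratChar u') u' (natCast_ratChar_mem u') (x₀ u')) := fun u' => by
    rw [hDx, absRamificationIdx_rescaledCompletion T.K (ratChar u') (placeOfM T.D u' (x₀ u'))
      (natCast_mem_placeOfM T.D (ratChar u') u' (natCast_ratChar_mem u') (x₀ u'))]
    exact differentOrd_rescaledCompletion T.K (ratChar u') (placeOfM T.D u' (x₀ u')) _
  -- the local type at `u`: `e = A·l`, `A` in the class
  have hpu : ((ratChar u : ℕ) : 𝓞 T.K) ∈ (placeOfM T.D u (x₀ u)).asIdeal := natCast_mem_placeOfM T.D (ratChar u) u (natCast_ratChar_mem u) (x₀ u)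
  have hw : ((ratChar u : ℕ) : 𝓞 T.F) ∈ (finBelow T.F T.K (placeOfM T.D u (x₀ u))).asIdeal := by
    rw [Cor22.natCast_mem_asIdeal_iff_residueChar_eq _ hp, residueChar_finBelow]
    exact residueChar_eq_of_natCast_mem (ratChar u) hpu
  set A : ℕ := (finBelow T.F T.K (placeOfM T.D u (x₀ u))).asIdeal.ramificationIdx ℤ with hAdef
  set e : ℕ := absRamificationIdx (ratChar u) (kOfM T.D (ratChar u) u (natCast_ratChar_mem u) (x₀ u)) with hedef
  have heAl : e = A * l := GenuineM.absRamificationIdx_kOfM_eq_mul_prime_ratPoint T u hp2 hpl hpole' (x₀ u)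
  obtain ⟨hc1, hc15, hcup, hcup'⟩ := GenuineK.ramificationIdx_F_wild_class_ratPoint T hpq ht hpole _ hw
  obtain ⟨a₀, hlo, hhi, hneg⟩ := hcell A hc1 hc15 hcup hcup'
  have he0 : 0 < e := absRamificationIdx_pos (ratChar u) _
  have he0r : (0 : ℝ) < e := by exact_mod_cast he0
  have hAl0 : 0 < A * l := by rw [← heAl]; exact he0
  have hAl0r : (0 : ℝ) < ((A * l : ℕ) : ℝ) := by exact_mod_cast hAl0
  have heK : e = (placeOfM T.D u (x₀ u)).asIdeal.ramificationIdx ℤ :=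
    absRamificationIdx_rescaledCompletion T.K (ratChar u) (placeOfM T.D u (x₀ u)) hpu
  -- the member is bad; `m_q(u) = A·t`
  obtain ⟨hS, -⟩ := placeModOfM_mem_S_and_norm_tqM_le_of_ratPoint T.D (ratChar u) u (natCast_ratChar_mem u) r q₀ T.j_eq T.isP5Choice
    (x₀ u) hp2 hpl (2 * t) (by omega) (fun u' hu' => by rw [hpole u' hu']; push_cast; exact le_rfl)
  have hn1 := norm_tqM_eq_rpow_ord_rat T.D (ratChar u) u (natCast_ratChar_mem u) r (x₀ u) hS (Cor22.jInv q₀) hjF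
  rw [hpole _ (natGenerator_finBelow_placeModOfM T.D (ratChar u) u (natCast_ratChar_mem u) (x₀ u)), hmq u,
    DHCrudeLog.norm_unif_zpow_eq_rpow (ratChar u) (hϖ u) (mq u), ← hedef] at hn1
  have hmqAt : mq u = ((A * t : ℕ) : ℤ) := by
    have h1 : -((mq u : ℝ) / (e : ℝ)) = ((-(2 * (t : ℤ)) : ℤ) : ℝ) / (2 * l) :=
      le_antisymm ((Real.rpow_le_rpow_left_iff hpR).mp hn1.le) ((Real.rpow_le_rpow_left_iff hpR).mp hn1.ge)
    rw [heAl] at h1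
    have hl0' : (l : ℝ) ≠ 0 := hl0r.ne'
    have hA0r : (0 : ℝ) < A := by
      have : 0 < A := Ideal.ramificationIdx_pos _ _
      exact_mod_cast this
    push_cast at h1
    field_simp at h1
    have h2 : ((mq u : ℝ)) = (A : ℝ) * t := by nlinarith [hA0r, hl0r]
    exact_mod_cast h2
  -- one-sided bounds on the exact data: `R_in ≤ r_in`, `r_out ≤ R_out`, `D ≤ δ`
  have hpm1pos : 0 < ratChar u - 1 := by have := hp.two_le; omega
  have hRinle : Rin u ≤ (((A * l) / (ratChar u - 1) + 1 : ℕ) : ℤ) := by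
    have hr : 1 / (((ratChar u : ℕ) : ℝ) - 1) < ((((((A * l) / (ratChar u - 1) + 1 : ℕ) : ℤ)) : ℝ)) / (e : ℝ) := by
      rw [heAl]
      have hdiv : A * l < (ratChar u - 1) * ((A * l) / (ratChar u - 1) + 1) := Nat.lt_mul_div_succ (A * l) hpm1pos
      rw [lt_div_iff₀ hAl0r]
      have hdivr : (((A * l : ℕ)) : ℝ) < (((ratChar u - 1 : ℕ)) : ℝ) * ((((A * l) / (ratChar u - 1) + 1 : ℕ)) : ℝ) := by
        exact_mod_cast hdiv
      have hp1r : (((ratChar u - 1 : ℕ)) : ℝ) = ((ratChar u : ℕ) : ℝ) - 1 := by rw [Nat.cast_sub hp.one_lt.le]; simp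
      rw [hp1r] at hdivr
      have hpos : (0 : ℝ) < ((ratChar u : ℕ) : ℝ) - 1 := by linarith
      simp only [Int.cast_natCast]
      rw [div_mul_eq_mul_div, one_mul, div_lt_iff₀ hpos]
      linarith
    have h := HexHullThreshold.rpow_le_norm_of_innerRadius (ratChar u) _ (hunif u) (hwv u) (hwle u) hr
    rw [hRin u, DHCrudeLog.norm_unif_zpow_eq_rpow (ratChar u) (hϖ u) (Rin u), ← hedef] at h
    exact le_of_rpow_neg_div_le hp.one_lt he0r h
  have hRoutge : ((ratChar u : ℕ) : ℤ) ^ a₀ - (a₀ : ℤ) * ((A * l : ℕ) : ℤ) ≤ Rout u := by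
    have hlo' : ∀ a < a₀, (1 : ℤ) * ((ratChar u : ℕ) : ℤ) ^ a * (((ratChar u : ℕ) : ℤ) - 1) < e := by
      rw [heAl]; exact fun a ha => hlo a ha
    have hhi' : (e : ℤ) ≤ 1 * ((ratChar u : ℕ) : ℤ) ^ a₀ * (((ratChar u : ℕ) : ℤ) - 1) := by rw [heAl]; exact hhi
    have h := HexHullThreshold.norm_le_rpow_of_mem_logUnits_turning (ratChar u) _ hlo' hhi' (houtΛ u)
    rw [hRout u, DHCrudeLog.norm_unif_zpow_eq_rpow (ratChar u) (hϖ u) (Rout u), ← hedef] at h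
    have h' : ((ratChar u : ℕ) : ℝ) ^ (-((Rout u : ℝ) / (e : ℝ))) ≤
        ((ratChar u : ℕ) : ℝ) ^ (-((((((ratChar u : ℕ) : ℤ) ^ a₀ - (a₀ : ℤ) * (e : ℤ) : ℤ)) : ℝ) / (e : ℝ))) := by
      convert h using 2
      push_cast
      ring
    have := le_of_rpow_neg_div_le hp.one_lt he0r h'
    rw [heAl] at this
    exact_mod_cast this
  have hDxle : (Dx u : ℤ) ≤ (((A * l - 1 + (if ratChar u ∣ A then A * l else 0) : ℕ) : ℕ) : ℤ) := by
    have h1 := multiplicity_differentIdeal_int_le_dedekind T.K (ratChar u) (placeOfM T.D u (x₀ u)) hpu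
    rw [← heK, heAl, ← hDx] at h1
    have h2 := GenuineK.mul_prime_factorization_le_ite hpq hl hpl hcup
    have h3 : Dx u ≤ A * l - 1 + (if ratChar u ∣ A then A * l else 0) := h1.trans (Nat.add_le_add_left h2 _)
    exact_mod_cast h3
  have hAl0z : (0 : ℤ) < ((A * l : ℕ) : ℤ) := by exact_mod_cast hAl0
  have hi1 : (0 : ℤ) ≤ (i : ℤ) + 1 := by positivity
  have heZ : (e : ℤ) = ((A * l : ℕ) : ℤ) := by rw [heAl]
  -- the EXACT cell at `(u, i)` from the licence (abc-iut-w5-d166's decider), and the sandwich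
  have hexact := (licence_settingPrVolSharpM_tOfIdeleData_iff_orders_of_j_mem_range T.D (logvAnalyticVal_analyticLogvVal (K := T.K)) r
    M archPk archSub Ψ act Mmod region n lat sig split qData
    (fun u x => tqM_ne_zero T.D (ratChar u) u (natCast_ratChar_mem u) r x) (GenuineM.finite_ratPlaces_under_S T.D).toFinset
    (fun u x hu => norm_tqM_eq_one_of_not_mem T.D (ratChar u) u (natCast_ratChar_mem u) r x
      fun hx => hu ((Set.Finite.mem_toFinset _).mpr ⟨x, hx⟩))
    x₀ ϖ hϖ Dx hD cin cout hin (fun u' => ⟨ϖ' u', wv u', hunif u', hwv u', hwle u'⟩) houtΛ hdom Rin Rout hRin hRout mq hmq hj).mp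
    hL u ⟨i, hil⟩
  rw [← hedef] at hexact
  push_cast at hexact
  rw [heZ, hmqAt] at hexact
  exact sandwich_false hAl0z hi1 hDxle hRinle hRoutge hexact hneg

/-- **abc-TRIPLE form of the M engine** (`a + b = c` coprime, `λ = a/c`, `p_u = p ∈ {3, 5}`, `p ≠ l`, `p^t ∥ abc`, label `i + 1 ≤ l⋆`, the
`δ`-cells failing at every member of the class): ¬ S_H at the summand-route M-level sharp setting of the datum's own ideles (pinned reading) for
EVERY genuine Θ-volume datum over `(ratPoint (a/c), l)` and every choice of the free context binders and Kummer data. M twin of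
`GenuineK.not_pilotKummerCompatHull_chosen_triple_of_wildCells` (SAME cell hypothesis). NOT claimed: admissibility / Szpiro-badness / (P6),
non-emptiness. [cite: Mochizuki2012, IUTchIV Cor. 2.2 (ii) proof p. 44; IUTchIII Cor. 3.12 Step (xi-f) p. 184] [cite: SilvermanAEC2009, Prop. III.1.7(b)]
[claim: Mochizuki2012, status: disputed] -/
theorem GenuineM.not_pilotKummerCompatHull_triple_of_wildCells {a b c : ℕ} (habc : IsABCTriple a b c) {l : ℕ}
    (T : Cor22.ThetaVolumeDatumAt (ratPoint ((a : ℚ) / c)) l) (u : FinitePlace ℚ) (p : ℕ) (hu : ratChar u = p) {p' : ℕ}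
    (hpq : (p = 3 ∧ p' = 5) ∨ (p = 5 ∧ p' = 3)) (hpl : p ≠ l) {t : ℕ} (ht : 0 < t)
    (hdvd : p ^ t ∣ a * b * c) (hndvd : ¬ p ^ (t + 1) ∣ a * b * c) {i : ℕ} (hi : i + 1 ≤ (l - 1) / 2)
    (hcell : ∀ A : ℕ, (p - 1) ∣ A → 15 ∣ A * t → A ∣ p * (p - 1) * p' →
      (p' ∣ t → A ∣ p * (p - 1)) →
      ∃ a₀ : ℕ, (∀ a, a < a₀ → (1 : ℤ) * ((p : ℕ) : ℤ) ^ a * (((p : ℕ) : ℤ) - 1) < ((A * l : ℕ) : ℤ)) ∧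
        ((A * l : ℕ) : ℤ) ≤ 1 * ((p : ℕ) : ℤ) ^ a₀ * (((p : ℕ) : ℤ) - 1) ∧
        ((A * t : ℕ) : ℤ) - (((i : ℕ) : ℤ) + 1 + 1) * (((p : ℕ) : ℤ) ^ a₀ - (a₀ : ℤ) * ((A * l : ℕ) : ℤ)) <
          ((A * l : ℕ) : ℤ) * (((((i : ℕ) : ℤ) + 1) ^ 2 * ((A * t : ℕ) : ℤ)
            - (((i : ℕ) : ℤ) + 1) * (((A * l - 1 + (if p ∣ A then A * l else 0) : ℕ) : ℤ))
            - (((i : ℕ) : ℤ) + 1 + 1) * (((A * l) / (p - 1) + 1 : ℕ) : ℤ)) / ((A * l : ℕ) : ℤ))) :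
    letI := T.instFieldF; letI := T.instNumberFieldF; letI := T.instAlgebraF; letI := T.instFieldK
    letI := T.instNumberFieldK; letI := T.instAlgebraK; letI := T.instFieldFbar; letI := T.instAlgebraFbar
    letI := T.instAlgebraKFbar; letI := T.instIsElliptic
    ∀ (M : Type) [Field M] [NumberField M]
      (archPk : ∀ (j : (thetaIndexOfInitial T.D).Label) (vQ : (thetaIndexOfInitial T.D).VQ),
        Set ((logShellsOfInitialDH T.D (analyticLogvVal T.K)).Packet j vQ))
      (archSub : ∀ (j : (thetaIndexOfInitial T.D).Label) (v : (thetaIndexOfInitial T.D).V),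
        Set ((logShellsOfInitialDH T.D (analyticLogvVal T.K)).Packet j ((thetaIndexOfInitial T.D).over v)))
      (Ψ : ℤ → ∀ v : (thetaIndexOfInitial T.D).V, v ∈ (thetaIndexOfInitial T.D).Vbad →
        Set ((logShellsOfInitialDH T.D (analyticLogvVal T.K)).StarPacket v))
      (act : ℤ → ∀ v : (thetaIndexOfInitial T.D).V, v ∈ (thetaIndexOfInitial T.D).Vbad →
        (logShellsOfInitialDH T.D (analyticLogvVal T.K)).StarPacket v →
          Module.End ℚ ((logShellsOfInitialDH T.D (analyticLogvVal T.K)).StarPacket v))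
      (Mmod : ℤ → ∀ j : (thetaIndexOfInitial T.D).LabelStar, Set ((logShellsOfInitialDH T.D (analyticLogvVal T.K)).GlobalPacket j.1))
      (region : ℤ → ∀ j : (thetaIndexOfInitial T.D).LabelStar, FinDivisor M → ∀ vQ : (thetaIndexOfInitial T.D).VQ,
        Set ((logShellsOfInitialDH T.D (analyticLogvVal T.K)).Packet j.1 vQ))
      (frobAdm : ℤ → ℤ → ∀ (j : (thetaIndexOfInitial T.D).Label) (vQ : (thetaIndexOfInitial T.D).VQ),
        Set ((logShellsOfInitialDH T.D (analyticLogvVal T.K)).Packet j vQ) → Prop)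
      (frobLogvol : ℤ → ℤ → ∀ (j : (thetaIndexOfInitial T.D).Label) (vQ : (thetaIndexOfInitial T.D).VQ),
        Set ((logShellsOfInitialDH T.D (analyticLogvVal T.K)).Packet j vQ) → ℝ)
      (frobΨ : ℤ → ℤ → ∀ v : (thetaIndexOfInitial T.D).V, v ∈ (thetaIndexOfInitial T.D).Vbad →
        Set ((logShellsOfInitialDH T.D (analyticLogvVal T.K)).StarPacket v))
      (frobMmod : ℤ → ℤ → ∀ j : (thetaIndexOfInitial T.D).LabelStar, Set ((logShellsOfInitialDH T.D (analyticLogvVal T.K)).GlobalPacket j.1))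
      (unitImage : ℤ → ℤ → ℕ → ∀ (j : (thetaIndexOfInitial T.D).Label) (vQ : (thetaIndexOfInitial T.D).VQ),
        Set ((logShellsOfInitialDH T.D (analyticLogvVal T.K)).Packet j vQ))
      (ballImage : ℤ → ℤ → ∀ (j : (thetaIndexOfInitial T.D).Label) (vQ : (thetaIndexOfInitial T.D).VQ),
        Set ((logShellsOfInitialDH T.D (analyticLogvVal T.K)).Packet j vQ))
      (thetaDiv : ℤ → ℤ → LgpDivisor M (thetaIndexOfInitial T.D).lstar)
      (n : ℤ) {HT : Type} {LogLink : HT → HT → Type} {IsFull : ∀ {s t : HT}, LogLink s t → Prop}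
      (lat : LGPGaussianLogThetaLattice LogLink IsFull)
      {Frd : Type} {IsoF : Frd → Frd → Type} {Ob : Frd → Type} {realify : Frd → Frd} {Strip : Type}
      {IsoS : Strip → Strip → Type} {Mv : ∀ v : (thetaIndexOfInitial T.D).V, v ∈ (thetaIndexOfInitial T.D).Vbad → Type}
      [∀ v h, Monoid (Mv v h)]
      (sig : GlobalLGPFrobenioidSignature (thetaIndexOfInitial T.D).lstar (thetaIndexOfInitial T.D).V
        (· ∈ (thetaIndexOfInitial T.D).Vbad) Frd IsoF Ob realify Strip IsoS Mv)
      (split : SplittingMonoids Mv) {ObΔ : Type} {N : ∀ v : (thetaIndexOfInitial T.D).V, v ∈ (thetaIndexOfInitial T.D).Vbad → Type}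
      [∀ v h, Monoid (N v h)] (qData : QPilotData ObΔ N)
      (qK : ∀ v : (thetaIndexOfInitial T.D).V, v ∈ (thetaIndexOfInitial T.D).Vbad →
        Set ((logShellsOfInitialDH T.D (analyticLogvVal T.K)).StarPacket v)),
      ¬ Cor312Vol.PilotKummerCompatHull
        (LatticeSituation.ofShells (logShellsOfInitialDH T.D (analyticLogvVal T.K)) M archPk archSub
          (summandPiecesPrM T.D (logvAnalyticVal_analyticLogvVal (K := T.K))).Adm (summandPiecesPrM T.D (logvAnalyticVal_analyticLogvVal (K := T.K))).logvol Ψ act Mmod region frobAdm frobLogvol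
          frobΨ frobMmod unitImage ballImage thetaDiv)
        (settingPrVolSharpM T.D (logvAnalyticVal_analyticLogvVal (K := T.K)) (tOfIdeleData T.D (ideleDataOf T.D T.isVolumeInputOf))
          (fun u x => tqM T.D (ratChar u) u (natCast_ratChar_mem u) (ideleDataOf T.D T.isVolumeInputOf) x) M archPk archSub Ψ act Mmod region n lat sig split qData
          (fun u x => tqM_ne_zero T.D (ratChar u) u (natCast_ratChar_mem u) (ideleDataOf T.D T.isVolumeInputOf) x)
          (GenuineM.finite_ratPlaces_under_S T.D).toFinset
          (fun u x hu => norm_tqM_eq_one_of_not_mem T.D (ratChar u) u (natCast_ratChar_mem u) (ideleDataOf T.D T.isVolumeInputOf) x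
            fun hx => hu ((Set.Finite.mem_toFinset _).mpr ⟨x, hx⟩)))
        (fun _ => Cor312.Setting.qRegion
          (settingPrVolSharpM T.D (logvAnalyticVal_analyticLogvVal (K := T.K)) (tOfIdeleData T.D (ideleDataOf T.D T.isVolumeInputOf))
          (fun u x => tqM T.D (ratChar u) u (natCast_ratChar_mem u) (ideleDataOf T.D T.isVolumeInputOf) x) M archPk archSub Ψ act Mmod region n lat sig split qData
          (fun u x => tqM_ne_zero T.D (ratChar u) u (natCast_ratChar_mem u) (ideleDataOf T.D T.isVolumeInputOf) x)
          (GenuineM.finite_ratPlaces_under_S T.D).toFinset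
          (fun u x hu => norm_tqM_eq_one_of_not_mem T.D (ratChar u) u (natCast_ratChar_mem u) (ideleDataOf T.D T.isVolumeInputOf) x
            fun hx => hu ((Set.Finite.mem_toFinset _).mpr ⟨x, hx⟩)))) qK := by
  have hp : p.Prime := by rcases hpq with ⟨rfl, -⟩ | ⟨rfl, -⟩ <;> norm_num
  have hp2 : p ≠ 2 := by rcases hpq with ⟨h, -⟩ | ⟨h, -⟩ <;> omega
  have habc0 : a * b * c ≠ 0 := by
    obtain ⟨ha, hb, hsum, -⟩ := habc
    exact Nat.mul_ne_zero (Nat.mul_ne_zero ha.ne' hb.ne') (by omega)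
  have htv : (a * b * c).factorization p = t := by
    have h1 : t ≤ (a * b * c).factorization p := (hp.pow_dvd_iff_le_factorization habc0).1 hdvd
    have h2 : ¬ t + 1 ≤ (a * b * c).factorization p := fun h => hndvd ((hp.pow_dvd_iff_le_factorization habc0).2 h)
    omega
  have hdvd1 : p ∣ a * b * c := (dvd_pow_self _ ht.ne').trans hdvd
  have hpole : ∀ v : HeightOneSpectrum (𝓞 ℚ), Rat.HeightOneSpectrum.natGenerator v = p →
      Literature.IUT.LogVolume.ord ℚ v (Cor22.jInv ((a : ℚ) / c)) = -(2 * (t : ℤ)) := by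
    intro v hv
    rw [Cor22.ord_jInv_ratPoint_triple_eq habc v (by rw [hv]; exact hp2) (by rw [hv]; exact hdvd1), hv, htv]
  exact GenuineM.not_pilotKummerCompatHull_ratPoint_of_wildCells T u p hu hpq hpl ht hpole hi hcell

end Summit.ABC.IUTFork.Conditional

end
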